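import Summits.HodgeConjecture.HodgeConjecture.Theorems.F0P3cStCharTSBigCellFactorisation   -- ★ FILE 1 (this seat): T4 inside `G`, `toFun_weylElt_mul_eq_of_isUnit` (exact cell function), `neg_one_mem_normOneUnits`
import Literature.NumberTheory.Automorphic.CMBorelAdmissibleTorusRay                             -- ★ `exists_torus_coe_localNonsplitEquiv_eq_diagonal`, `torusEntry_apply_eq_…`, `units_apply_ne_zero`; brings ★ `unitModulusChar_lt_one_of_forall_v_lt_one`, ★ `valued_conjLocal_apply_of_smul_eq`
import HarnessLib

/-!
# F0 · P3c · line LH6 «StCharTS» — «CELL FUNCTION FAR OUT★» (organ level, `U(Φ₃)(L⁺_v)`, `v` NON-SPLIT): the cell function `n ↦ f(w₀ n)` of ANY smooth vector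
# `f ∈ i_G(χ₁, χ₂)` is EXPLICIT far out on the big cell — `f(w₀ n) = (χ₁(σ b)⁻¹ · χ₂(−1) · ‖b‖⁻¹) • f(1)` for `b = n₀₂` a unit of large modulus
# [Keys1984 §7 Thm. (1); Rogawski1990 §1.10, §12.1–12.2; Casselman1995 Prop. 1.3.3, §6.4]

Cell `pub/hodgecm-mathlib`, crux H413 = `stmt-HodgeConjecture-24833` (lane `--supports … --as helper`), route HCCMUnconditional; seat LH6-p04 (g10), twin of the
ROAD «KEYS3-ANALYTIC» holder F0P2-p06 (g21) (LEAD F0P3a-plan T15-03 (b); deal 2026-09-02T23:20:46Z, sigsheet «=» on the HEAD 23:30:46Z): FILE 2 of 2 of brick **B4** of MEMO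
`F0/P2/F0P2-p06/g21/MEMO-KEYS3-analytic-road.v3` §1∕§4 (FILE 1 = ★ `F0P3cStCharTSBigCellFactorisation`).  THEOREMS ONLY (0 def ∕ 0 instance ∕ 0 notation ∕ 0 sorry); ★-only imports.

WHAT.  `R = ∏_{w ∣ v} L_w` (`v` a finite place of `L⁺` NON-SPLIT in the CM field `L`, `w ∣ v` its place), `σ = c ⊗ 1`, `G = U(Φ₃)(L⁺_v)`, `N` the unipotent radical of its Borel,
`w₀ ∈ G` of matrix `Φ₃`, `u ∈ N` with entries `a = u₀₁`, `b = u₀₂`; FILE 1 gives `w₀ u = U · (w₀ u′ w₀⁻¹)` and `f(w₀ u) = χ₁(σ b)⁻¹ χ₂(−1) ‖b‖⁻¹ · f(w₀ u′ w₀⁻¹)`.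
* §3 `valued_entry_zero_one_sq_le`: `|a|_w² ≤ |b|_w` (unitarity relation `aσa = −(b + σb)`, `|σx|_w = |x|_w`, ultrametric); **`weylConj_mem_of_le_valued`**: for every neighbourhood
  `V` of `1` in `G` there is `γ₀ ≠ 0` with `w₀ u′ w₀⁻¹ ∈ V` whenever `γ₀ ≤ |b|_w` (the chart coordinates `a b⁻¹`, `b⁻¹ + ½ (ab⁻¹)σ(ab⁻¹)` of `u′` tend to `0`, ★
  `HeisRing.heisHomeomorph`, Mathlib `Valued.mem_nhds_zero`); `exists_unitModulusChar_le_imp_le_valued`: `‖c‖ ≥ A₀ ⇒ |c_w| ≥ γ₀` (one place above `v`).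
* §4 THE HEAD **`exists_toFun_weylElt_mul_eq_smul_toFun_one`** (the road holder's shape, `nrm`-free): for every `f` in the carrier of ★ `cmPrincipalSeries L 3 v (cmTorusCharPair L v χ₁ χ₂)`
  there is `A₀ : ℝ≥0` such that for every `u ∈ N` whose `b = u₀₂` is a unit with `‖b‖ ≥ A₀`:  `f(w₀ u) = (χ₁(σ b)⁻¹ · χ₂(−1) · ‖b‖⁻¹) • f(1)` — the stabiliser of the smooth
  vector `f` is open (★ `Representation.isSmooth_smoothInd`), so `f(w₀ u′ w₀⁻¹) = f(1)` far out.
WHY (MEMO v3 §1 «CELL FUNCTION FAR OUT»): with `F(n) := f₀(w₀ n)` (`f₀(1) = 1`) this is the closed form `F(n) = χ₁(σ z)⁻¹ · χ₂(−1) · ‖z‖_R⁻¹` of the integrand of the annulus formula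
`Λ(g₀(m)) = ± χ(m) ∫_{shell} F`, whose vanishing for `‖α‖ ≠ 1` is the analytic half of Keys' reducibility theorem, case (3) [Keys1984 §7 Thm. (1); Rogawski1990 §12.2 (3)] —
RUNG 0's outer input `hKeysRed3` (B6 of the road).  No case split by ramification, no `‖2‖`, no residue field in any statement.
HONEST LABEL: HC_CM is proved only modulo the 7 printed citations (2 remaining named inputs: hLiu418 = `stmt-HodgeConjecture-24832`, h413 = `stmt-HodgeConjecture-24833`) until
rung 0 closes; count-neutral organ-level computation (no node closes here).

## References
* [Keys1984] D. Keys, *Principal series representations of special unitary groups over local fields*, Compositio Math. 51 (1984), §7 Thm. (1) p. 126.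
* [Rogawski1990] J. D. Rogawski, *Automorphic Representations of Unitary Groups in Three Variables*, Ann. of Math. Stud. 123 (1990), §1.10 p. 9, §12.1 p. 171, §12.2 (3) p. 174.
* [Casselman1995] W. Casselman, *Introduction to the theory of admissible representations of p-adic reductive groups* (1995), Prop. 1.3.3 (the big cell), §6.4 (asymptotics of
  sections on the big cell, intertwining integrals).
-/

set_option autoImplicit false
-- the mandated namespace has the single-problem summit's repeated segment (`HodgeConjecture.HodgeConjecture`)
set_option linter.dupNamespace false

noncomputable section

open NumberField IsDedekindDomain MeasureTheory Topology Filter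
open scoped Matrix MatrixGroups NNReal
open Literature.NumberTheory.Automorphic Literature.NumberTheory.Automorphic.UnitaryGroup
open Summit.HodgeConjecture.HodgeConjecture.Cruxes.H413.F0P3cStCharTSBigCellFactorisation

namespace Summit.HodgeConjecture.HodgeConjecture.Cruxes.H413.F0P3cStCharTSCellFunFarOut

/-! ## §3 `v` NON-SPLIT: far out on the big cell the lower factor `w₀ u′ w₀⁻¹` tends to `1`; modulus versus valuation at the one place above `v` -/

section Nonsplit

variable (L : Type) [Field L] [NumberField L] [IsCMField L] (v : HeightOneSpectrum (𝓞 ↥(maximalRealSubfield L)))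
  (w : PlacesOver L v) (hw : IsCMField.complexConj L • w.1 = w.1)
  (w₀ : ↥(unitaryGroupOfForm (conjLocal L (IsCMField.complexConj L) v) (cmLocalForm L 3 v)))
  (hw₀ : Units.val (w₀ : GL (Fin 3) (LocalRing L v)) = cmLocalForm L 3 v)

include hw in
/-- **`|a|_w² ≤ |b|_w` on `N`** at a non-split place (`w ∣ v`): `a σa = −(b + σb)` (★ `HeisRing.umat_zero_two_add_map`) and `|σ x|_w = |x|_w`
(★ `valued_conjLocal_apply_of_smul_eq`), so `|a|_w² = |b + σb|_w ≤ |b|_w` (ultrametric inequality) — print's `‖x‖² ≤ ‖z‖` on `u(x, z)`. [cite: Rogawski1990, §1.10 p. 9] -/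
theorem valued_entry_zero_one_sq_le (u : ↥(cmBorelTriple L 3 v).N) :
    Valued.v ((((u : ↥(unitaryGroupOfForm (conjLocal L (IsCMField.complexConj L) v) (cmLocalForm L 3 v))) : GL (Fin 3) (LocalRing L v)) :
        Matrix (Fin 3) (Fin 3) (LocalRing L v)) 0 1 w) *
      Valued.v ((((u : ↥(unitaryGroupOfForm (conjLocal L (IsCMField.complexConj L) v) (cmLocalForm L 3 v))) : GL (Fin 3) (LocalRing L v)) :
        Matrix (Fin 3) (Fin 3) (LocalRing L v)) 0 1 w) ≤
      Valued.v ((((u : ↥(unitaryGroupOfForm (conjLocal L (IsCMField.complexConj L) v) (cmLocalForm L 3 v))) : GL (Fin 3) (LocalRing L v)) :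
        Matrix (Fin 3) (Fin 3) (LocalRing L v)) 0 2 w) := by
  set a : LocalRing L v := (((u : ↥(unitaryGroupOfForm (conjLocal L (IsCMField.complexConj L) v) (cmLocalForm L 3 v))) : GL (Fin 3) (LocalRing L v)) :
        Matrix (Fin 3) (Fin 3) (LocalRing L v)) 0 1 with ha
  set b : LocalRing L v := (((u : ↥(unitaryGroupOfForm (conjLocal L (IsCMField.complexConj L) v) (cmLocalForm L 3 v))) : GL (Fin 3) (LocalRing L v)) :
        Matrix (Fin 3) (Fin 3) (LocalRing L v)) 0 2 with hb
  have h := HeisRing.umat_zero_two_add_map (conjLocal L (IsCMField.complexConj L) v) (conjLocal_conjLocal_cm L v) (cmLocalForm_eq_over L 3 v) u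
  rw [← ha, ← hb] at h
  have hw' : a w * (conjLocal L (IsCMField.complexConj L) v a) w = -(b w + (conjLocal L (IsCMField.complexConj L) v b) w) := by
    have := congr_fun h w
    simp only [Pi.add_apply, Pi.neg_apply, Pi.mul_apply] at this
    linear_combination this
  calc Valued.v (a w) * Valued.v (a w)
      = Valued.v (a w) * Valued.v ((conjLocal L (IsCMField.complexConj L) v a) w) := by rw [valued_conjLocal_apply_of_smul_eq L v w hw a]
    _ = Valued.v (-(b w + (conjLocal L (IsCMField.complexConj L) v b) w)) := by rw [← map_mul, hw']
    _ = Valued.v (b w + (conjLocal L (IsCMField.complexConj L) v b) w) := Valuation.map_neg _ _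
    _ ≤ max (Valued.v (b w)) (Valued.v ((conjLocal L (IsCMField.complexConj L) v b) w)) := Valuation.map_add _ _ _
    _ = Valued.v (b w) := by rw [valued_conjLocal_apply_of_smul_eq L v w hw b, max_self]

include hw in
set_option maxHeartbeats 1600000 in
/-- **FAR OUT, THE LOWER FACTOR IS NEAR `1`**: for every neighbourhood `V` of `1` in `G = U(Φ₃)(L⁺_v)` (`v` non-split, `w ∣ v`) there is a valuation bound `γ₀ ≠ 0` such that
for every `u ∈ N` with `γ₀ ≤ |u₀₂|_w` and every `u′ ∈ N` of entries `(u₀₁ u₀₂⁻¹, u₀₂⁻¹)` (stated multiplicatively), `w₀ u′ w₀⁻¹ ∈ V`: the coordinates `x′ = a b⁻¹`,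
`y′ = b⁻¹ + ½ x′σx′` of `u′` in the Heisenberg chart ★ `HeisRing.heisHomeomorph` have `|x′|_w² ≤ |b|_w⁻¹`, `|y′|_w ≤ max(1, |½|_w)·|b|_w⁻¹`, so `u′ → 1`, and conjugation by
`w₀` is continuous; the valuation balls come from Mathlib's `Valued.mem_nhds_zero` at the one place above `v` (★ `PlacesOver.subsingleton_of_smul_eq`).
[cite: Casselman1995, §6.4] [cite: Rogawski1990, §1.10 p. 9] -/
theorem weylConj_mem_of_le_valued (V : Set ↥(unitaryGroupOfForm (conjLocal L (IsCMField.complexConj L) v) (cmLocalForm L 3 v)))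
    (hV : V ∈ 𝓝 (1 : ↥(unitaryGroupOfForm (conjLocal L (IsCMField.complexConj L) v) (cmLocalForm L 3 v)))) :
    ∃ γ₀ : WithZero (Multiplicative ℤ), γ₀ ≠ 0 ∧
      ∀ u u' : ↥(cmBorelTriple L 3 v).N,
        γ₀ ≤ Valued.v ((((u : ↥(unitaryGroupOfForm (conjLocal L (IsCMField.complexConj L) v) (cmLocalForm L 3 v))) : GL (Fin 3) (LocalRing L v)) :
          Matrix (Fin 3) (Fin 3) (LocalRing L v)) 0 2 w) →
        (((u' : ↥(unitaryGroupOfForm (conjLocal L (IsCMField.complexConj L) v) (cmLocalForm L 3 v))) : GL (Fin 3) (LocalRing L v)) :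
            Matrix (Fin 3) (Fin 3) (LocalRing L v)) 0 1 *
          (((u : ↥(unitaryGroupOfForm (conjLocal L (IsCMField.complexConj L) v) (cmLocalForm L 3 v))) : GL (Fin 3) (LocalRing L v)) :
            Matrix (Fin 3) (Fin 3) (LocalRing L v)) 0 2 =
          (((u : ↥(unitaryGroupOfForm (conjLocal L (IsCMField.complexConj L) v) (cmLocalForm L 3 v))) : GL (Fin 3) (LocalRing L v)) :
            Matrix (Fin 3) (Fin 3) (LocalRing L v)) 0 1 →
        (((u' : ↥(unitaryGroupOfForm (conjLocal L (IsCMField.complexConj L) v) (cmLocalForm L 3 v))) : GL (Fin 3) (LocalRing L v)) :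
            Matrix (Fin 3) (Fin 3) (LocalRing L v)) 0 2 *
          (((u : ↥(unitaryGroupOfForm (conjLocal L (IsCMField.complexConj L) v) (cmLocalForm L 3 v))) : GL (Fin 3) (LocalRing L v)) :
            Matrix (Fin 3) (Fin 3) (LocalRing L v)) 0 2 = 1 →
        w₀ * (u' : ↥(unitaryGroupOfForm (conjLocal L (IsCMField.complexConj L) v) (cmLocalForm L 3 v))) * w₀⁻¹ ∈ V := by
  classical
  haveI : Subsingleton (PlacesOver L v) :=
    PlacesOver.subsingleton_of_smul_eq (IsCMField.complexConj L) (IsCMField.complexConj_ne_one L) w hw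
  letI : Invertible (2 : LocalRing L v) := (isUnit_two_localRing L v).invertible
  have hσ := conjLocal_conjLocal_cm L v
  have hσc := continuous_conjLocal L (IsCMField.complexConj L) v
  have hJ := cmLocalForm_eq_over L 3 v
  -- the chart `R × R⁻ ≃ₜ N` and the conjugation map
  set h := HeisRing.heisHomeomorph (J := cmLocalForm L 3 v) (conjLocal L (IsCMField.complexConj L) v) hσ hσc hJ with hhdef
  have hX1 : HeisRing.heisX (conjLocal L (IsCMField.complexConj L) v) (1 : ↥(cmBorelTriple L 3 v).N) = 0 := by
    rw [HeisRing.heisX_def, OneMemClass.coe_one, OneMemClass.coe_one, Units.val_one]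
    exact Matrix.one_apply_ne (by decide)
  have h1 : h.symm 1 = 0 := by
    rw [hhdef, HeisRing.heisHomeomorph_symm_apply]
    refine Prod.ext hX1 (Subtype.ext ?_)
    rw [HeisRing.coe_heisY, hX1, OneMemClass.coe_one, OneMemClass.coe_one, Units.val_one, Matrix.one_apply_ne (by decide)]
    simp
  have h0 : h 0 = 1 := by rw [← h1, Homeomorph.apply_symm_apply]
  have hcont : Continuous fun p : LocalRing L v × ↥(HeisRing.skewPart (conjLocal L (IsCMField.complexConj L) v)) =>
      w₀ * ((h p : ↥(cmBorelTriple L 3 v).N) : ↥(unitaryGroupOfForm (conjLocal L (IsCMField.complexConj L) v) (cmLocalForm L 3 v))) * w₀⁻¹ :=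
    (continuous_const.mul (continuous_subtype_val.comp h.continuous)).mul continuous_const
  have hpt : w₀ * ((h 0 : ↥(cmBorelTriple L 3 v).N) : ↥(unitaryGroupOfForm (conjLocal L (IsCMField.complexConj L) v) (cmLocalForm L 3 v))) * w₀⁻¹ = 1 := by
    rw [h0, OneMemClass.coe_one, mul_one, mul_inv_cancel]
  have hS : (fun p : LocalRing L v × ↥(HeisRing.skewPart (conjLocal L (IsCMField.complexConj L) v)) =>
      w₀ * ((h p : ↥(cmBorelTriple L 3 v).N) : ↥(unitaryGroupOfForm (conjLocal L (IsCMField.complexConj L) v) (cmLocalForm L 3 v))) * w₀⁻¹) ⁻¹' V ∈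
        𝓝 (0 : LocalRing L v × ↥(HeisRing.skewPart (conjLocal L (IsCMField.complexConj L) v))) :=
    hcont.continuousAt.preimage_mem_nhds (by rw [hpt]; exact hV)
  obtain ⟨V₁, hV₁, V₂, hV₂, hprod⟩ := mem_nhds_prod_iff.1 hS
  -- valuation balls inside `V₁` and `V₂` (one place above `v`)
  obtain ⟨γ₁, hγ₁0, hγ₁⟩ : ∃ γ₁ : WithZero (Multiplicative ℤ), γ₁ ≠ 0 ∧ ∀ x : LocalRing L v, Valued.v (x w) < γ₁ → x ∈ V₁ := by
    rw [nhds_pi, Filter.mem_pi] at hV₁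
    obtain ⟨I, -, t, ht, hsub⟩ := hV₁
    obtain ⟨g, hg⟩ := Valued.mem_nhds_zero.1 (ht w)
    refine ⟨MonoidWithZeroHom.ValueGroup₀.embedding g.1, MonoidWithZeroHom.ValueGroup₀.embedding_unit_ne_zero g,
      fun x hx => hsub fun i _ => ?_⟩
    obtain rfl : i = w := Subsingleton.elim i w
    exact hg ((Valuation.restrict_lt_iff_lt_embedding _).2 hx)
  obtain ⟨γ₂, hγ₂0, hγ₂⟩ : ∃ γ₂ : WithZero (Multiplicative ℤ), γ₂ ≠ 0 ∧ ∀ y : ↥(HeisRing.skewPart (conjLocal L (IsCMField.complexConj L) v)),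
      Valued.v ((y : LocalRing L v) w) < γ₂ → y ∈ V₂ := by
    obtain ⟨V₂', hV₂', hsub'⟩ := (mem_nhds_subtype _ _ _).1 hV₂
    rw [ZeroMemClass.coe_zero, nhds_pi, Filter.mem_pi] at hV₂'
    obtain ⟨I, -, t, ht, hsub⟩ := hV₂'
    obtain ⟨g, hg⟩ := Valued.mem_nhds_zero.1 (ht w)
    refine ⟨MonoidWithZeroHom.ValueGroup₀.embedding g.1, MonoidWithZeroHom.ValueGroup₀.embedding_unit_ne_zero g,
      fun y hy => hsub' (hsub fun i _ => ?_)⟩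
    obtain rfl : i = w := Subsingleton.elim i w
    exact hg ((Valuation.restrict_lt_iff_lt_embedding _).2 hy)
  -- the common bound `γ` and the threshold `γ₀`
  set γ : WithZero (Multiplicative ℤ) := min γ₁ γ₂ with hγdef
  have hγ0 : γ ≠ 0 := (lt_min (zero_lt_iff.2 hγ₁0) (zero_lt_iff.2 hγ₂0)).ne'
  set c : WithZero (Multiplicative ℤ) := Valued.v ((⅟(2 : LocalRing L v)) w) with hcdef
  have hc0 : c ≠ 0 := by
    rw [hcdef]
    intro hc
    have h21 : (⅟(2 : LocalRing L v)) w * (2 : LocalRing L v) w = 1 := by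
      rw [← Pi.mul_apply, invOf_mul_self, Pi.one_apply]
    have := congrArg Valued.v h21
    rw [map_mul, map_one, hc, zero_mul] at this
    exact zero_ne_one this
  set N : ℤ := |WithZero.log c| + 2 * |WithZero.log γ| + 1 with hN
  refine ⟨WithZero.exp N, WithZero.exp_ne_zero, fun u u' hB hx hz => ?_⟩
  -- names
  set a : LocalRing L v := (((u : ↥(unitaryGroupOfForm (conjLocal L (IsCMField.complexConj L) v) (cmLocalForm L 3 v))) : GL (Fin 3) (LocalRing L v)) :
        Matrix (Fin 3) (Fin 3) (LocalRing L v)) 0 1 with ha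
  set b : LocalRing L v := (((u : ↥(unitaryGroupOfForm (conjLocal L (IsCMField.complexConj L) v) (cmLocalForm L 3 v))) : GL (Fin 3) (LocalRing L v)) :
        Matrix (Fin 3) (Fin 3) (LocalRing L v)) 0 2 with hb
  set x' : LocalRing L v := (((u' : ↥(unitaryGroupOfForm (conjLocal L (IsCMField.complexConj L) v) (cmLocalForm L 3 v))) : GL (Fin 3) (LocalRing L v)) :
        Matrix (Fin 3) (Fin 3) (LocalRing L v)) 0 1 with hx'
  set z' : LocalRing L v := (((u' : ↥(unitaryGroupOfForm (conjLocal L (IsCMField.complexConj L) v) (cmLocalForm L 3 v))) : GL (Fin 3) (LocalRing L v)) :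
        Matrix (Fin 3) (Fin 3) (LocalRing L v)) 0 2 with hz'
  have hB0 : Valued.v (b w) ≠ 0 := (lt_of_lt_of_le WithZero.exp_pos hB).ne'
  have hlogB : N ≤ WithZero.log (Valued.v (b w)) := (WithZero.le_log_iff_exp_le hB0).2 hB
  have hAA : Valued.v (a w) * Valued.v (a w) ≤ Valued.v (b w) := valued_entry_zero_one_sq_le L v w hw u
  have hxw : Valued.v (x' w) * Valued.v (b w) = Valued.v (a w) := by
    rw [← map_mul, ← Pi.mul_apply, hx]
  have hzw : Valued.v (z' w) * Valued.v (b w) = 1 := by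
    rw [← map_mul, ← Pi.mul_apply, hz, Pi.one_apply, map_one]
  have hn1 := le_abs_self (WithZero.log γ)
  have hn2 := neg_abs_le (WithZero.log γ)
  have hc1 := le_abs_self (WithZero.log c)
  have hc2 := neg_abs_le (WithZero.log c)
  -- `|x'|_w < γ` and `2 log |x'| ≤ - log |b|`
  have hx2 : Valued.v (x' w) ≠ 0 → 2 * WithZero.log (Valued.v (x' w)) ≤ -WithZero.log (Valued.v (b w)) := by
    intro hx0
    have hA0 : Valued.v (a w) ≠ 0 := by rw [← hxw]; exact mul_ne_zero hx0 hB0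
    have e1 : WithZero.log (Valued.v (x' w)) + WithZero.log (Valued.v (b w)) = WithZero.log (Valued.v (a w)) := by
      rw [← WithZero.log_mul hx0 hB0, hxw]
    have e2 : WithZero.log (Valued.v (a w)) + WithZero.log (Valued.v (a w)) ≤ WithZero.log (Valued.v (b w)) := by
      rw [← WithZero.log_mul hA0 hA0]; exact (WithZero.log_le_log (mul_ne_zero hA0 hA0) hB0).2 hAA
    omega
  have hx_lt : Valued.v (x' w) < γ := by
    by_cases hx0 : Valued.v (x' w) = 0
    · rw [hx0]; exact zero_lt_iff.2 hγ0
    · have := hx2 hx0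
      exact (WithZero.log_lt_log hx0 hγ0).1 (by omega)
  have hz_lt : Valued.v (z' w) < γ := by
    have hz0 : Valued.v (z' w) ≠ 0 := fun h0 => by rw [h0, zero_mul] at hzw; exact zero_ne_one hzw
    have e1 : WithZero.log (Valued.v (z' w)) + WithZero.log (Valued.v (b w)) = 0 := by
      rw [← WithZero.log_mul hz0 hB0, hzw, WithZero.log_one]
    exact (WithZero.log_lt_log hz0 hγ0).1 (by omega)
  have hq_lt : Valued.v ((⅟(2 : LocalRing L v) * (x' * conjLocal L (IsCMField.complexConj L) v x')) w) < γ := by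
    rw [Pi.mul_apply, Pi.mul_apply, map_mul, map_mul, valued_conjLocal_apply_of_smul_eq L v w hw x', ← hcdef]
    by_cases hx0 : Valued.v (x' w) = 0
    · rw [hx0, mul_zero, mul_zero]; exact zero_lt_iff.2 hγ0
    · have := hx2 hx0
      have hne : c * (Valued.v (x' w) * Valued.v (x' w)) ≠ 0 := mul_ne_zero hc0 (mul_ne_zero hx0 hx0)
      refine (WithZero.log_lt_log hne hγ0).1 ?_
      rw [WithZero.log_mul hc0 (mul_ne_zero hx0 hx0), WithZero.log_mul hx0 hx0]
      omega
  have hy_lt : Valued.v ((HeisRing.heisY (conjLocal L (IsCMField.complexConj L) v) hσ hJ u' : LocalRing L v) w) < γ := by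
    rw [HeisRing.coe_heisY]
    change Valued.v ((z' + ⅟(2 : LocalRing L v) * (x' * conjLocal L (IsCMField.complexConj L) v x')) w) < γ
    rw [Pi.add_apply]
    exact Valuation.map_add_lt _ hz_lt hq_lt
  -- conclude through the chart
  have hmem : (HeisRing.heisX (conjLocal L (IsCMField.complexConj L) v) u', HeisRing.heisY (conjLocal L (IsCMField.complexConj L) v) hσ hJ u') ∈ V₁ ×ˢ V₂ :=
    ⟨hγ₁ _ (lt_of_lt_of_le hx_lt (min_le_left _ _)), hγ₂ _ (lt_of_lt_of_le hy_lt (min_le_right _ _))⟩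
  have hfin := hprod hmem
  rw [Set.mem_preimage, hhdef, HeisRing.heisHomeomorph_apply, HeisRing.heisElt_heisX_heisY] at hfin
  exact hfin

include hw in
/-- **Modulus versus valuation at the one place above `v`**: for every `γ₀` there is `A₀ : ℝ≥0` with `A₀ ≤ ‖c‖ ⇒ γ₀ ≤ |c_w|` for all units `c` of `R = ∏_{w′ ∣ v} L_{w′}`
(`A₀ := ‖c₀‖` for a unit `c₀` with `|c₀|_w = γ₀`, built on the torus ray of ★ `exists_torus_coe_localNonsplitEquiv_eq_diagonal`; if `|c|_w < |c₀|_w` then `d := c₀ c⁻¹` has `|d⁻¹|_w < 1`,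
so `‖d⁻¹‖ < 1` by ★ `unitModulusChar_lt_one_of_forall_v_lt_one`, contradicting `‖d‖ = ‖c₀‖ ∕ ‖c‖ ≤ 1`). [cite: Rogawski1990, §12.2 p. 173] [cite: Casselman1995, §6.4] -/
theorem exists_unitModulusChar_le_imp_le_valued (γ₀ : WithZero (Multiplicative ℤ)) :
    ∃ A₀ : ℝ≥0, ∀ c : (LocalRing L v)ˣ, A₀ ≤ unitModulusChar (LocalRing L v) c → γ₀ ≤ Valued.v ((c : LocalRing L v) w) := by
  haveI : Subsingleton (PlacesOver L v) :=
    PlacesOver.subsingleton_of_smul_eq (IsCMField.complexConj L) (IsCMField.complexConj_ne_one L) w hw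
  by_cases hγ : γ₀ = 0
  · exact ⟨0, fun c _ => by rw [hγ]; exact zero_le⟩
  obtain ⟨β, hβ⟩ := IsDedekindDomain.HeightOneSpectrum.valuedAdicCompletion_surjective L w.1 γ₀
  have hβ0 : β ≠ 0 := fun h0 => hγ (by rw [← hβ, h0, map_zero])
  obtain ⟨t, ht⟩ := exists_torus_coe_localNonsplitEquiv_eq_diagonal L v w hw hβ0
  obtain ⟨hc₀, -⟩ := torusEntry_apply_eq_of_coe_localNonsplitEquiv_eq_diagonal L v w hw t ht
  set c₀ : (LocalRing L v)ˣ := torusEntry (conjLocal L (IsCMField.complexConj L) v) (cmLocalForm L 3 v) 0 t with hc₀def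
  refine ⟨unitModulusChar (LocalRing L v) c₀, fun c hc => ?_⟩
  rw [← hβ, ← hc₀]
  by_contra hlt
  rw [not_le] at hlt
  -- `d := c₀ c⁻¹` has `|d⁻¹|_w < 1`, hence `‖d⁻¹‖ < 1`, hence `‖d‖ > 1`; but `‖d‖ ≤ 1`
  have hcv0 : Valued.v ((c : LocalRing L v) w) ≠ 0 := by
    intro h0
    have := units_apply_ne_zero L v w c
    exact this ((Valuation.zero_iff _).1 h0)
  have hc₀v0 : Valued.v ((c₀ : LocalRing L v) w) ≠ 0 := fun h0 => units_apply_ne_zero L v w c₀ ((Valuation.zero_iff _).1 h0)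
  have hdinv : Valued.v ((((c₀ * c⁻¹)⁻¹ : (LocalRing L v)ˣ) : LocalRing L v) w) < 1 := by
    rw [mul_inv_rev, inv_inv, Units.val_mul, Pi.mul_apply, map_mul]
    -- `|c|_w · |c₀⁻¹|_w < 1` from `|c|_w < |c₀|_w` and `|c₀⁻¹|_w |c₀|_w = 1`
    have hprod : Valued.v (((c₀⁻¹ : (LocalRing L v)ˣ) : LocalRing L v) w) * Valued.v ((c₀ : LocalRing L v) w) = 1 := by
      rw [← map_mul, ← Pi.mul_apply, ← Units.val_mul, inv_mul_cancel, Units.val_one, Pi.one_apply, map_one]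
    have hi0 : Valued.v (((c₀⁻¹ : (LocalRing L v)ˣ) : LocalRing L v) w) ≠ 0 := fun h0 => by rw [h0, zero_mul] at hprod; exact zero_ne_one hprod
    have e1 : WithZero.log (Valued.v (((c₀⁻¹ : (LocalRing L v)ˣ) : LocalRing L v) w)) + WithZero.log (Valued.v ((c₀ : LocalRing L v) w)) = 0 := by
      rw [← WithZero.log_mul hi0 hc₀v0, hprod, WithZero.log_one]
    have e2 := (WithZero.log_lt_log hcv0 hc₀v0).2 hlt
    refine (WithZero.log_lt_log (mul_ne_zero hcv0 hi0) one_ne_zero).1 ?_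
    rw [WithZero.log_mul hcv0 hi0, WithZero.log_one]
    omega
  have hnorm : unitModulusChar (LocalRing L v) (c₀ * c⁻¹)⁻¹ < 1 :=
    unitModulusChar_lt_one_of_forall_v_lt_one L v _ fun w' => by rw [Subsingleton.elim w' w]; exact hdinv
  -- `‖d‖ ‖d⁻¹‖ = 1` and `‖d‖ ‖c‖ = ‖c₀‖ ≤ ‖c‖`
  have hmul : unitModulusChar (LocalRing L v) (c₀ * c⁻¹) * unitModulusChar (LocalRing L v) (c₀ * c⁻¹)⁻¹ = 1 := by
    rw [← map_mul, mul_inv_cancel, map_one]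
  have hmul' : unitModulusChar (LocalRing L v) (c₀ * c⁻¹) * unitModulusChar (LocalRing L v) c = unitModulusChar (LocalRing L v) c₀ := by
    rw [← map_mul, inv_mul_cancel_right]
  have hcpos : 0 < unitModulusChar (LocalRing L v) c := pos_iff_ne_zero.2 (by
    intro h0
    have h1 : unitModulusChar (LocalRing L v) c * unitModulusChar (LocalRing L v) c⁻¹ = 1 := by rw [← map_mul, mul_inv_cancel, map_one]
    rw [h0, zero_mul] at h1
    exact zero_ne_one h1)
  -- `‖d‖ ≤ 1`
  have hd_le : unitModulusChar (LocalRing L v) (c₀ * c⁻¹) ≤ 1 := by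
    by_contra hgt
    rw [not_le] at hgt
    have : unitModulusChar (LocalRing L v) c < unitModulusChar (LocalRing L v) c₀ := by
      rw [← hmul']
      calc unitModulusChar (LocalRing L v) c = 1 * unitModulusChar (LocalRing L v) c := (one_mul _).symm
        _ < unitModulusChar (LocalRing L v) (c₀ * c⁻¹) * unitModulusChar (LocalRing L v) c := mul_lt_mul_of_pos_right hgt hcpos
    exact (not_lt.2 hc) this
  -- `‖d‖ > 1`: contradiction
  have : unitModulusChar (LocalRing L v) (c₀ * c⁻¹) * unitModulusChar (LocalRing L v) (c₀ * c⁻¹)⁻¹ < 1 :=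
    calc unitModulusChar (LocalRing L v) (c₀ * c⁻¹) * unitModulusChar (LocalRing L v) (c₀ * c⁻¹)⁻¹
        ≤ 1 * unitModulusChar (LocalRing L v) (c₀ * c⁻¹)⁻¹ := mul_le_mul_of_nonneg_right hd_le zero_le
      _ < 1 := by rw [one_mul]; exact hnorm
  rw [hmul] at this
  exact lt_irrefl _ this

end Nonsplit

/-! ## §4 THE HEAD: the cell function of a smooth vector is explicit far out on the big cell -/

section Head

variable (L : Type) [Field L] [NumberField L] [IsCMField L] (v : HeightOneSpectrum (𝓞 ↥(maximalRealSubfield L)))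
  (hns : ∀ w : PlacesOver L v, IsCMField.complexConj L • w.1 = w.1)
  (χ₁ : (LocalRing L v)ˣ →* ℂˣ) (χ₂ : ↥(normOneUnits (conjLocal L (IsCMField.complexConj L) v)) →* ℂˣ)
  (w₀ : ↥(unitaryGroupOfForm (conjLocal L (IsCMField.complexConj L) v) (cmLocalForm L 3 v)))
  (hw₀ : Units.val (w₀ : GL (Fin 3) (LocalRing L v)) = cmLocalForm L 3 v)

set_option synthInstance.maxHeartbeats 400000 in
set_option maxHeartbeats 1600000 in
-- statement over the `SmoothInd` carrier of ★ `cmPrincipalSeries` (class of ★ `F0P3U3PrincipalSeriesOpenCellTorusChar`)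
include hns hw₀ in
/-- **«CELL FUNCTION FAR OUT★» (B4 of the road «KEYS3-ANALYTIC»)**: `v` NON-SPLIT, `w₀` the element of matrix `Φ₃`, `f` ANY vector of the carrier of ★
`cmPrincipalSeries L 3 v (cmTorusCharPair L v χ₁ χ₂)`.  There is `A₀ : ℝ≥0` such that for every `u ∈ N` whose entry `b = u₀₂` is a unit of modulus `‖b‖ ≥ A₀`:
  `f(w₀ u) = (χ₁(σ b)⁻¹ · χ₂(−1) · ‖b‖⁻¹) • f(1)`
(§2 + §3: the stabiliser of `f` under right translation is open — `f` is a smooth vector, ★ `Representation.isSmooth_smoothInd` — so `f(w₀ u′ w₀⁻¹) = f(1)` once `|b|_w` is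
large, and `‖b‖ ≥ A₀` forces that).  For the standard section `f₀` (`f₀(1) = 1`) this is MEMO v3 §1's `F(n) = χ₁(σ z)⁻¹ · χ₂(−1) · ‖z‖_R⁻¹`, the integrand of the annulus
formula of Keys' case (3). [cite: Keys1984, §7 Thm. (1) p. 126] [cite: Rogawski1990, §12.1 p. 171; §12.2 (3) p. 174] [cite: Casselman1995, §6.4] -/
theorem exists_toFun_weylElt_mul_eq_smul_toFun_one
    (f : haveI := locallyCompactSpace_cmBorelU L 3 v
      Representation.SmoothInd (cmBorelTriple L 3 v).P
        (Representation.twist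
          (((Representation.trivial ℂ ↥(torusU (conjLocal L (IsCMField.complexConj L) v) (cmLocalForm L 3 v)) ℂ).twist
            (cmTorusCharPair L v χ₁ χ₂)).comp (cmBorelTriple L 3 v).proj) (rootDeltaChar (cmBorelTriple L 3 v).P))) :
    ∃ A₀ : ℝ≥0, ∀ (u : ↥(cmBorelTriple L 3 v).N)
      (hb : IsUnit ((((u : ↥(unitaryGroupOfForm (conjLocal L (IsCMField.complexConj L) v) (cmLocalForm L 3 v))) : GL (Fin 3) (LocalRing L v)) :
        Matrix (Fin 3) (Fin 3) (LocalRing L v)) 0 2)),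
      A₀ ≤ unitModulusChar (LocalRing L v) hb.unit →
        f.toFun (w₀ * (u : ↥(unitaryGroupOfForm (conjLocal L (IsCMField.complexConj L) v) (cmLocalForm L 3 v)))) =
          ((((χ₁ (Units.map (conjLocal L (IsCMField.complexConj L) v : LocalRing L v →* LocalRing L v) hb.unit))⁻¹ : ℂˣ) : ℂ) *
              ((χ₂ ⟨-1, neg_one_mem_normOneUnits (conjLocal L (IsCMField.complexConj L) v)⟩ : ℂˣ) : ℂ) *
              ((((unitModulusChar (LocalRing L v) hb.unit)⁻¹ : ℝ≥0) : ℝ) : ℂ)) • f.toFun 1 := by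
  haveI := locallyCompactSpace_cmBorelU L 3 v
  obtain ⟨w⟩ : Nonempty (PlacesOver L v) := inferInstance
  have hw := hns w
  letI : Invertible (2 : LocalRing L v) := (isUnit_two_localRing L v).invertible
  have hσ := conjLocal_conjLocal_cm L v
  have hJ := cmLocalForm_eq_over L 3 v
  -- the stabiliser of the smooth vector `f` is an open neighbourhood of `1`
  have hopen : IsOpen (((Representation.smoothIndRep (cmBorelTriple L 3 v).P _).stabilizerSubgroup f :
      Subgroup ↥(unitaryGroupOfForm (conjLocal L (IsCMField.complexConj L) v) (cmLocalForm L 3 v))) :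
        Set ↥(unitaryGroupOfForm (conjLocal L (IsCMField.complexConj L) v) (cmLocalForm L 3 v))) :=
    Representation.isSmooth_smoothInd _ _ f
  have hV := hopen.mem_nhds (Subgroup.one_mem _)
  obtain ⟨γ₀, -, hγ₀⟩ := weylConj_mem_of_le_valued L v w hw w₀ _ hV
  obtain ⟨A₀, hA₀⟩ := exists_unitModulusChar_le_imp_le_valued L v w hw γ₀
  refine ⟨A₀, fun u hb hle => ?_⟩
  obtain ⟨u', h1, h2⟩ := exists_unipotentU_entries_eq (conjLocal L (IsCMField.complexConj L) v) hσ hJ u hb.unit hb.unit_spec.symm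
  have hexact := toFun_weylElt_mul_eq_of_isUnit L v χ₁ χ₂ w₀ hw₀ f u u' hb.unit hb.unit_spec.symm h1 h2
  -- far out: the lower factor stabilises `f`
  have hval : γ₀ ≤ Valued.v ((((u : ↥(unitaryGroupOfForm (conjLocal L (IsCMField.complexConj L) v) (cmLocalForm L 3 v))) : GL (Fin 3) (LocalRing L v)) :
      Matrix (Fin 3) (Fin 3) (LocalRing L v)) 0 2 w) := by
    have := hA₀ hb.unit hle
    rwa [hb.unit_spec] at this
  have hx : (((u' : ↥(unitaryGroupOfForm (conjLocal L (IsCMField.complexConj L) v) (cmLocalForm L 3 v))) : GL (Fin 3) (LocalRing L v)) :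
        Matrix (Fin 3) (Fin 3) (LocalRing L v)) 0 1 *
      (((u : ↥(unitaryGroupOfForm (conjLocal L (IsCMField.complexConj L) v) (cmLocalForm L 3 v))) : GL (Fin 3) (LocalRing L v)) :
        Matrix (Fin 3) (Fin 3) (LocalRing L v)) 0 2 =
      (((u : ↥(unitaryGroupOfForm (conjLocal L (IsCMField.complexConj L) v) (cmLocalForm L 3 v))) : GL (Fin 3) (LocalRing L v)) :
        Matrix (Fin 3) (Fin 3) (LocalRing L v)) 0 1 := by
    rw [h1, mul_assoc, hb.val_inv_mul, mul_one]
  have hz : (((u' : ↥(unitaryGroupOfForm (conjLocal L (IsCMField.complexConj L) v) (cmLocalForm L 3 v))) : GL (Fin 3) (LocalRing L v)) :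
        Matrix (Fin 3) (Fin 3) (LocalRing L v)) 0 2 *
      (((u : ↥(unitaryGroupOfForm (conjLocal L (IsCMField.complexConj L) v) (cmLocalForm L 3 v))) : GL (Fin 3) (LocalRing L v)) :
        Matrix (Fin 3) (Fin 3) (LocalRing L v)) 0 2 = 1 := by
    rw [h2, hb.val_inv_mul]
  have hmem := hγ₀ u u' hval hx hz
  have hfix : f.toFun (w₀ * (u' : ↥(unitaryGroupOfForm (conjLocal L (IsCMField.complexConj L) v) (cmLocalForm L 3 v))) * w₀⁻¹) = f.toFun 1 := by
    have h := Representation.mem_stabilizerSubgroup _ _ _ |>.1 hmem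
    have h' := congrArg (fun φ => Representation.SmoothInd.toFun φ 1) h
    simp only [Representation.toFun_smoothIndRep_apply, one_mul] at h'
    exact h'
  rw [hexact, hfix, smul_eq_mul]

end Head

end Summit.HodgeConjecture.HodgeConjecture.Cruxes.H413.F0P3cStCharTSCellFunFarOut

end
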